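import Literature.Geometry.Lorentzian.FinalState
import Literature.Geometry.Lorentzian.ModelDataProofs
import Literature.Geometry.Lorentzian.ModelDataCompletenessProofs
import Literature.Geometry.Lorentzian.LeviCivitaProofs
import HarnessLib

/-!
# The trivial data are Christodoulou-admissible: `admissibleVacuumData` is inhabited

Anti-vacuity of the admissible class `admissibleVacuumData X` (`FinalState.lean`) consumed by
the summit statement `FinalStateConjecture` and by every route of that summit: the trivial
initial data `trivialData = (δ, 0)` on the Minkowski slice `Minkowski.slice ≅ ℝ³`
(`ModelData.lean`) belong to `admissibleVacuumData Minkowski.slice`. All four clauses are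
assembled from theorems already in the tree:

* vacuum constraints — `trivialData_isVacuumConstraintSolution_holds` (`ModelDataProofs`);
* completeness — `isComplete_trivialData_holds` (`ModelDataCompletenessProofs`);
* the end `trivialAFEnd` (`U = {1 < ‖y‖}`, tautological chart) is the SOLE end of the slice —
  proved here (`isSoleEnd_trivialAFEnd`): the complement of the far region `{2 < ‖y‖}` is the
  closed ball `{‖y‖ ≤ 2}`, compact in `ℝ³`;
* Dafermos–Rodnianski strong asymptotic flatness with mass `0` — from the
  Christodoulou–Klainerman rates `trivialAFEnd_isStronglyAsymptoticallyFlatCK_holds`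
  (`ModelDataProofs`) by `IsStronglyAsymptoticallyFlatCK.isStronglyAsymptoticallyFlatDR`.

Consequence recorded: `admissibleVacuumData Minkowski.slice` is nonempty, so statements of the
shape `∀ D ∈ admissibleVacuumData X, …` (the anti-vacuity conjunct of `FinalStateConjecture`,
the shared item `MGHDExists`, the targets of the routes) are not vacuously true on `X = ℝ³`.

## References

* D. Christodoulou, CQG 16 (1999) A23, p. A24 (the admissible class).
* D. Christodoulou, S. Klainerman, *The global nonlinear stability of the Minkowski space*
  (1993), (1.0.9) (strong asymptotic flatness of order CK; trivial data).
* R. Bartnik, CPAM 39 (1986), §1, §4 (structure of infinity; one end).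
-/

noncomputable section

open Set TopologicalSpace Metric
open scoped Manifold ContDiff Topology

namespace Literature.Geometry.Lorentzian

/-- The far region `{R' < ‖y‖}` of the end `trivialAFEnd` of the Minkowski slice, for `1 ≤ R'`,
is literally the set of points of the slice of Euclidean norm `> R'` (the chart of an inclusion
end is the identity in ambient coordinates). Bartnik 1986, §1. [cite: Bartnik1986, §1] -/
theorem far_trivialAFEnd {R' : ℝ} (hR' : 1 ≤ R') :
    trivialAFEnd.far R' = {y : Minkowski.slice | R' < ‖(y : E3)‖} := by
  ext y
  simp only [AFEnd.far, mem_image, mem_preimage, mem_setOf_eq]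
  constructor
  · rintro ⟨z, hz, rfl⟩
    exact hz
  · intro hy
    exact ⟨⟨y, lt_of_le_of_lt hR' hy⟩, hy, rfl⟩

/-- **The Minkowski slice has exactly one end**: `trivialAFEnd.IsSoleEnd`. The complement of the
far region `{2 < ‖y‖}` is `{‖y‖ ≤ 2}`, the preimage of the closed ball of radius `2` under the
inclusion `Minkowski.slice ↪ E3`, which is a closed embedding with image everything; closed
balls of `ℝ³` are compact. Bartnik 1986, §4 ("complete, one end"); Schoen–Yau 1979.
[cite: Bartnik1986, §4] -/
theorem isSoleEnd_trivialAFEnd : trivialAFEnd.IsSoleEnd := by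
  refine ⟨2, by simp, ?_⟩
  rw [far_trivialAFEnd (by norm_num)]
  have hset : ({y : Minkowski.slice | (2 : ℝ) < ‖(y : E3)‖})ᶜ =
      ((↑) : Minkowski.slice → E3) ⁻¹' closedBall (0 : E3) 2 := by
    ext y
    simp [not_lt]
  rw [hset]
  have hcl : IsClosed ((Minkowski.slice : Opens E3) : Set E3) := by
    simp [Minkowski.slice]
  exact hcl.isClosedEmbedding_subtypeVal.isCompact_preimage (isCompact_closedBall (0 : E3) 2)

/-- **The trivial data are admissible**: `trivialData ∈ admissibleVacuumData Minkowski.slice` —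
`(ℝ³, δ, 0)` is a smooth, complete solution of the vacuum constraints with one strongly
asymptotically flat end of mass `0` (Christodoulou, CQG 16 (1999), p. A24: the admissible class;
Christodoulou–Klainerman 1993, (1.0.9): the trivial data). Assembled from
`trivialData_isVacuumConstraintSolution_holds`, `isComplete_trivialData_holds`,
`isSoleEnd_trivialAFEnd` and `trivialAFEnd_isStronglyAsymptoticallyFlatCK_holds` (CK rates imply
DR rates). [cite: Christodoulou1999, p. A24] -/
theorem trivialData_mem_admissibleVacuumData :
    trivialData ∈ admissibleVacuumData Minkowski.slice :=
  ⟨fun {_} ↦ ⟨trivialData_isVacuumConstraintSolution_holds, isComplete_trivialData_holds⟩,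
    trivialAFEnd, 0, isSoleEnd_trivialAFEnd,
    trivialAFEnd_isStronglyAsymptoticallyFlatCK_holds.isStronglyAsymptoticallyFlatDR⟩

/-- **Anti-vacuity of the admissible class**: `admissibleVacuumData Minkowski.slice` is nonempty
(it contains the trivial data). Christodoulou, CQG 16 (1999), p. A24. [cite: Christodoulou1999, p. A24] -/
theorem admissibleVacuumData_slice_nonempty :
    (admissibleVacuumData Minkowski.slice).Nonempty :=
  ⟨trivialData, trivialData_mem_admissibleVacuumData⟩

end Literature.Geometry.Lorentzian

end
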